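import Literature.NumberTheory.GaloisRepresentations.DecompositionGroupOfCompletion
import Literature.NumberTheory.GaloisRepresentations.NeukirchHasseNF
import Literature.NumberTheory.GaloisRepresentations.ValuationSubringOverAbsPrime
import Literature.NumberTheory.GaloisRepresentations.AbsIntegersValuationSubringsMaximalIdeals
import Literature.GroupTheory.LocallyConstantCochainTransportSubgroup
import Literature.AnabelianGeometry.AbsoluteAnabelian.NeukirchUchidaTransportGamma
import Literature.AnabelianGeometry.AbsoluteAnabelian.NFDecompositionNestedProofs
import HarnessLib

/-!
# Level transport for Neukirch's lemma: `Gal(K̄/K_V) ≅ V ≤ Γ_ℚ` and the global axiom (AxH) at `V`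

Topic `NumberTheory/GaloisRepresentations`; namespace
`Literature.NumberTheory.GaloisRepresentations.ExplicitMuCocycles`.  Proof file: theorems only (no
definition, no instance, no named fact).  Classical algebraic number theory (abc-iut GAP-LEDGER row
G-L4d2g4-1, campaign L; assembly plan of abc-iut-w5-d055 `ASSEMBLY-PLAN.md`): the V-LEVEL form of
the global hypotheses of `NeukirchAbstract.exists_prime_smul_eq_of_localType` ([NSW] (12.1.9)) at
`Γ := absoluteGaloisGroup ℚ`.  For an open `V ≤ Γ`, abc-iut-w6-d055's R0 gives the number field
`K_V = KV V ⊆ Ω₀ = ℚ̄` with `galTransport : Gal(\bar K_V/K_V) ≃ₜ* Γ_{K_V} = V`; this file supplies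

* `exists_valuationSubring_map_decompositionSubgroup` — the LEVEL DICTIONARY: for a finite place `w`
  of `K_V`, the decomposition group `D_{𝔓₀(w)} ≤ Gal(\bar K_V/K_V)` of the explicit-cochain files
  (`adicCompletionPrime`) is carried by `galTransport` onto `Stab_Γ(A) ∩ Γ_{K_V}` for a nontrivial
  valuation subring `A` of `Ω₀` (w5-d055's `exists_valuationSubring_decompositionGroupNF_eq` + R0's
  `map_stabilizer_comap_galTransport`), with the topological isomorphism `D_{𝔓₀(w)} ≃ₜ* Stab_Γ(A) ∩ Γ_{K_V}`
  over `galTransport` (`exists_continuousMulEquiv_mapOfEquiv`);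
* `coboundaryOn_decompositionSubgroup_of_coboundaryOn_stabilizer` — explicit coboundaries on
  `Stab_Γ(A) ∩ Γ_{K_V}` pull back to coboundaries on `D_{𝔓₀(w)}`;
* **`axH_level`** — (AxH) at level `V`: for an open `V ≤ Stab_Γ(ζ)` (`ζ` a primitive `ℓ`-th root,
  `ℓ` an odd prime) an explicit cocycle on `V` which bounds on `Stab_Γ(A) ∩ V` for EVERY nontrivial
  valuation subring `A` of `Ω₀` bounds on `V` — abc-iut-w5-d055's full-group Hasse principle
  `coboundary_of_forall_coboundaryOn_decompositionSubgroup` at `K_V`, pulled back and pushed forward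
  along `galTransport` (`coboundaryOn_of_coboundary`).

HONEST FRAMING: classical (Brauer–Hasse–Noether through the tree); nothing here bears on [IUTchIII]
Cor. 3.12; no side taken.

## References

* J. Neukirch, A. Schmidt, K. Wingberg, *Cohomology of Number Fields* (2nd ed. 2008), XII §1
  Prop. (12.1.9). [NeukirchSchmidtWingberg2008]
* J. Neukirch, *Algebraic Number Theory* (1999), Ch. II §8–9. [NeukirchANT1999]
-/

noncomputable section

open scoped NumberField Pointwise
open Field IsDedekindDomain Function Topology

namespace Literature.NumberTheory.GaloisRepresentations.ExplicitMuCocycles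

open Literature.NumberTheory.GaloisRepresentations
open Literature.GroupTheory.LocallyConstantCocycles
open Literature.AnabelianGeometry.AbsoluteAnabelian (decompositionGroupNF decompositionGroupNF_eq_stabilizer)
open Literature.AnabelianGeometry.AbsoluteAnabelian.NeukirchUchidaProof

/-! ### The level dictionary along `galTransport` -/

section Dictionary

variable (K : IntermediateField ℚ (AlgebraicClosure ℚ)) [FiniteDimensional ℚ K] [NumberField K]

/-- **Level dictionary.**  For a finite place `w` of the number field `K ⊆ Ω₀` there is a nontrivial
valuation subring `A` of `Ω₀` such that `galTransport K` carries the decomposition group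
`D_{𝔓₀(w)} ≤ Gal(\bar K/K)` onto `Stab_Γ(A) ∩ Γ_K`. [cite: NeukirchANT1999, Ch. II §9 (9.6)]
[cite: NeukirchSchmidtWingberg2008, XII §1 (12.1.9)] -/
theorem exists_valuationSubring_map_decompositionSubgroup (w : HeightOneSpectrum (𝓞 K)) :
    ∃ A : ValuationSubring (AlgebraicClosure ℚ), A ≠ ⊤ ∧
      absIntegersCentre (A.comap (closureEquiv K : AlgebraicClosure K →+* AlgebraicClosure ℚ)) =
        adicCompletionPrime K w ∧
      (((adicCompletionPrime K w).decompositionSubgroup (absoluteGaloisGroup K)).map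
          (galTransport K).toMonoidHom).map (ΓK K).subtype =
        MulAction.stabilizer (absoluteGaloisGroup ℚ) A ⊓ ΓK K := by
  obtain ⟨A', hA', hcen, hD⟩ := exists_valuationSubring_decompositionGroupNF_eq (K := K)
    (adicCompletionPrime_mem_primesAbove K w)
  -- transport `A'` to `Ω₀` along `e_K`
  let A : ValuationSubring (AlgebraicClosure ℚ) :=
    A'.comap ((closureEquiv K).symm : AlgebraicClosure ℚ →+* AlgebraicClosure K)
  have hAA' : A.comap (closureEquiv K : AlgebraicClosure K →+* AlgebraicClosure ℚ) = A' := by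
    ext x
    rw [ValuationSubring.mem_comap, ValuationSubring.mem_comap]
    change (closureEquiv K).symm (closureEquiv K x) ∈ A' ↔ x ∈ A'
    rw [AlgEquiv.symm_apply_apply]
  have hA : A ≠ ⊤ := by
    rw [← comap_closureEquiv_ne_top_iff K A, hAA']
    exact hA'
  refine ⟨A, hA, ?_, ?_⟩
  · rw [hAA']
    ext s
    rw [mem_absIntegersCentre_iff]
    exact (hcen s).symm
  have key := map_stabilizer_comap_galTransport K A
  rw [hAA', ← decompositionGroupNF_eq_stabilizer, hD] at key
  rw [key, Subgroup.subgroupOf_map_subtype]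

/-- The isomorphism `D_{𝔓₀(w)} ≃ₜ* Stab_Γ(A) ∩ Γ_K` over `galTransport` supplied by the level dictionary.
[cite: NeukirchSchmidtWingberg2008, XII §1 (12.1.9)] -/
theorem exists_continuousMulEquiv_decompositionSubgroup_stabilizer (w : HeightOneSpectrum (𝓞 K)) :
    ∃ (A : ValuationSubring (AlgebraicClosure ℚ)) (_ : A ≠ ⊤)
      (_ : absIntegersCentre (A.comap (closureEquiv K : AlgebraicClosure K →+* AlgebraicClosure ℚ)) =
        adicCompletionPrime K w)
      (e : ↥((adicCompletionPrime K w).decompositionSubgroup (absoluteGaloisGroup K)) ≃ₜ*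
        ↥(MulAction.stabilizer (absoluteGaloisGroup ℚ) A ⊓ ΓK K)),
      ∀ d, ((e d : ↥(MulAction.stabilizer (absoluteGaloisGroup ℚ) A ⊓ ΓK K)) : absoluteGaloisGroup ℚ) =
        ((galTransport K d : ΓK K) : absoluteGaloisGroup ℚ) := by
  obtain ⟨A, hA, hcen, hmap⟩ := exists_valuationSubring_map_decompositionSubgroup K w
  obtain ⟨e, he⟩ := exists_continuousMulEquiv_mapOfEquiv (ΓK K) (galTransport K)
    ((adicCompletionPrime K w).decompositionSubgroup (absoluteGaloisGroup K))
  refine ⟨A, hA, hcen, ?_⟩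
  rw [← hmap]
  exact ⟨e, he⟩

/-- **Coboundaries descend along the level dictionary**: if an explicit cochain `f` on `Γ` bounds on
`Stab_Γ(A) ∩ Γ_K` for every nontrivial valuation subring `A` of `Ω₀`, then its pull-back
`(a, b) ↦ f (galTransport a) (galTransport b)` bounds on every decomposition group `D_{𝔓₀(w)}` of
`Gal(\bar K/K)`. [cite: NeukirchSchmidtWingberg2008, XII §1 (12.1.9)] -/
theorem coboundaryOn_decompositionSubgroup_of_forall {ℓ : ℕ}
    (f : absoluteGaloisGroup ℚ → absoluteGaloisGroup ℚ → ZMod ℓ)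
    (hloc : ∀ A : ValuationSubring (AlgebraicClosure ℚ), A ≠ ⊤ →
      ∃ β : absoluteGaloisGroup ℚ → ZMod ℓ,
        IsLocallyConstant (fun s : ↥(MulAction.stabilizer (absoluteGaloisGroup ℚ) A ⊓ ΓK K) => β s) ∧
        ∀ a ∈ MulAction.stabilizer (absoluteGaloisGroup ℚ) A ⊓ ΓK K,
          ∀ b ∈ MulAction.stabilizer (absoluteGaloisGroup ℚ) A ⊓ ΓK K, f a b = β a + β b - β (a * b))
    (w : HeightOneSpectrum (𝓞 K)) :
    ∃ γ : absoluteGaloisGroup K → ZMod ℓ,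
      IsLocallyConstant
        (fun s : ↥((adicCompletionPrime K w).decompositionSubgroup (absoluteGaloisGroup K)) => γ s) ∧
      ∀ a ∈ (adicCompletionPrime K w).decompositionSubgroup (absoluteGaloisGroup K),
        ∀ b ∈ (adicCompletionPrime K w).decompositionSubgroup (absoluteGaloisGroup K),
          f ((galTransport K a : ΓK K) : absoluteGaloisGroup ℚ)
              ((galTransport K b : ΓK K) : absoluteGaloisGroup ℚ) = γ a + γ b - γ (a * b) := by
  obtain ⟨A, hA, -, e, he⟩ := exists_continuousMulEquiv_decompositionSubgroup_stabilizer K w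
  exact coboundaryOn_pull ((adicCompletionPrime K w).decompositionSubgroup (absoluteGaloisGroup K))
    (MulAction.stabilizer (absoluteGaloisGroup ℚ) A ⊓ ΓK K) e
    (f := fun a b => f ((galTransport K a : ΓK K) : absoluteGaloisGroup ℚ)
      ((galTransport K b : ΓK K) : absoluteGaloisGroup ℚ))
    (f' := f) (fun a b => by rw [he, he]) (hloc A hA)

end Dictionary

/-! ### (AxH) at level `V` -/

/-- **(AxH) at an open level `V ≤ Stab_Γ(ζ)`** (`ζ ∈ Ω₀` a primitive `ℓ`-th root of unity, `ℓ` an odd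
prime): an explicit `ℤ/ℓ`-valued cochain which is locally constant and a `2`-cocycle on `V` and which
bounds on `Stab_Γ(A) ∩ V` for every nontrivial valuation subring `A` of `Ω₀` bounds on `V` — the
Hasse principle for `Br(K_V)[ℓ]` (abc-iut-w5-d055's `coboundary_of_forall_coboundaryOn_decompositionSubgroup`
at the number field `K_V ∋ ζ`) moved along `galTransport : Gal(\bar K_V/K_V) ≃ₜ* V`.
[cite: NeukirchSchmidtWingberg2008, XII §1 (12.1.9)] -/
theorem axH_level {ℓ : ℕ} (hℓ : ℓ.Prime) (hℓ2 : ℓ ≠ 2) {ζ : AlgebraicClosure ℚ}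
    (hζ : IsPrimitiveRoot ζ ℓ) (V : Subgroup (absoluteGaloisGroup ℚ))
    (hV : IsOpen (V : Set (absoluteGaloisGroup ℚ)))
    (hVζ : V ≤ MulAction.stabilizer (absoluteGaloisGroup ℚ) ζ)
    (f : absoluteGaloisGroup ℚ → absoluteGaloisGroup ℚ → ZMod ℓ)
    (hlc : IsLocallyConstant (fun q : V × V => f q.1 q.2))
    (hcoc : ∀ a ∈ V, ∀ b ∈ V, ∀ c ∈ V, f a b + f (a * b) c = f b c + f a (b * c))
    (hloc : ∀ A : ValuationSubring (AlgebraicClosure ℚ), A ≠ ⊤ →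
      ∃ β : absoluteGaloisGroup ℚ → ZMod ℓ,
        IsLocallyConstant (fun s : ↥(MulAction.stabilizer (absoluteGaloisGroup ℚ) A ⊓ V) => β s) ∧
        ∀ a ∈ MulAction.stabilizer (absoluteGaloisGroup ℚ) A ⊓ V,
          ∀ b ∈ MulAction.stabilizer (absoluteGaloisGroup ℚ) A ⊓ V, f a b = β a + β b - β (a * b)) :
    ∃ β : absoluteGaloisGroup ℚ → ZMod ℓ, IsLocallyConstant (fun s : V => β s) ∧
      ∀ a ∈ V, ∀ b ∈ V, f a b = β a + β b - β (a * b) := by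
  -- the number field `K = K_V` with `Γ_K = V`
  set K : IntermediateField ℚ (AlgebraicClosure ℚ) := KV V with hK
  haveI : FiniteDimensional ℚ K := finiteDimensional_KV V hV
  haveI : NumberField K := numberField_intermediateField K
  have hVe : ΓK K = V := ΓK_KV V hV
  rw [← hVe] at hlc hcoc hloc ⊢
  -- `ζ ∈ K` is a primitive `ℓ`-th root of unity of `K`
  have hζK : ζ ∈ K := by
    rw [hK, KV, IntermediateField.mem_fixedField_iff]
    rintro g ⟨v, hv, rfl⟩
    exact MulAction.mem_stabilizer_iff.mp (hVζ hv)
  have hζ' : IsPrimitiveRoot (⟨ζ, hζK⟩ : K) ℓ :=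
    IsPrimitiveRoot.of_map_of_injective (f := algebraMap K (AlgebraicClosure ℚ)) hζ
      (algebraMap K (AlgebraicClosure ℚ)).injective
  -- pull `f` back along `galTransport K : Gal(\bar K/K) ≃ₜ* Γ_K`
  set e := galTransport K with he
  let d : absoluteGaloisGroup K → absoluteGaloisGroup K → ZMod ℓ := fun a b =>
    f ((e a : ΓK K) : absoluteGaloisGroup ℚ) ((e b : ΓK K) : absoluteGaloisGroup ℚ)
  have hdlc : IsLocallyConstant (uncurry d) :=
    hlc.comp_continuous ((e.continuous.comp continuous_fst).prodMk (e.continuous.comp continuous_snd))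
  have hdcoc : ∀ a b c, d a b + d (a * b) c = d b c + d a (b * c) := fun a b c => by
    have h1 := hcoc _ (e a).2 _ (e b).2 _ (e c).2
    simp only [d]
    rw [map_mul, map_mul, Subgroup.coe_mul, Subgroup.coe_mul]
    exact h1
  -- local triviality on every decomposition group of `Gal(\bar K/K)`
  have hdloc := coboundaryOn_decompositionSubgroup_of_forall K f hloc
  -- the Hasse principle at `K`
  obtain ⟨βK, hβK, hd⟩ :=
    coboundary_of_forall_coboundaryOn_decompositionSubgroup K hℓ hℓ2 hζ' d hdlc hdcoc hdloc
  -- push forward along `galTransport`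
  exact coboundaryOn_of_coboundary (ΓK K) e (d := d) (f := f) (fun _ _ => rfl) hβK hd

end Literature.NumberTheory.GaloisRepresentations.ExplicitMuCocycles

end
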